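/-
Copyright (c) 2026 the pub-hodgecm-mathlib formalisation cell (harness21).  Prover seat hodgecm-mathlib-LH7-p04 (g3), 2026-09-02 (LH7 leaf ED. 3 road,
print organ O8a `PKsaU2Shape`: «a discrete automorphic representation on which the derived finite-adelic group acts trivially is an automorphic
character»).
-/
import Literature.NumberTheory.Automorphic.AutomorphicEigencharacter
import Literature.NumberTheory.Automorphic.UnitaryGroupFiniteAdelicDenseOrbit
import HarnessLib

/-!
# Scalar action of a subgroup with dense orbit forces a discrete automorphic representation to be an automorphic character

Topic `NumberTheory/Automorphic`; THEOREMS ONLY (no definition, no instance, no named fact, no notation, no `sorry`).  Assembles ★ `HilbertRepSchur`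
(Schur's lemma), ★ `AutomorphicCharacterLineSubgroup` (the eigenspace of a closed normal `M ≤ G(𝔸_K)` with `M · (A_G · G(K))` dense has dimension
`≤ 1`), ★ `AutomorphicEigencharacter` (one-dimensional discrete automorphic representations are `ofChar ψ`, `ψ` automorphic) and ★
`UnitaryGroupFiniteAdelicDenseOrbit` (`M = U(J)(𝔸_{F,f})` under weak approximation at `∞`).

* §1 **Schur for one element**: for a discrete automorphic `P` and `m ∈ G(𝔸_K)` whose commutators `g⁻¹ m⁻¹ g m` all act trivially on `P` (e.g. lie
  in a subgroup `N` acting trivially), `R(m)|_P` is a scalar (`DiscreteAutomorphicRep.exists_apply_eq_smul_of_forall_commutator_apply_eq_self`, ★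
  `IsTopIrreducible.exists_apply_eq_smul_of_commute`: `R(g) R(m) = R(m g) R(g⁻¹ m⁻¹ g m)`).
* §2 **`DiscreteAutomorphicRep.exists_eq_ofChar_of_forall_mem_apply_eq_smul`**: if a CLOSED NORMAL `M ≤ G(𝔸_K)` with `M · (A_G · G(K))` DENSE acts on
  `P` by scalars `c(m)` (NOT assumed to come from an automorphic character), then `P = ofChar ψ μ` for an automorphic character `ψ` of ALL of
  `G(𝔸_K)`: the `c`-eigenspace of `M` in `L²` has dimension `≤ 1` (★ `eq_zero_of_inner_eq_zero_of_forall_mem_rightRegular_apply_eq_smul`), so `P`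
  is one-dimensional, so ★ `exists_eq_ofChar_of_isOneDimensional` applies;
  **`DiscreteAutomorphicRep.exists_eq_ofChar_of_forall_mem_apply_eq_self_of_commutator_mem`**: the same when a subgroup `N` acts trivially on `P`
  and contains the commutators `g⁻¹ m⁻¹ g m`, `m ∈ M`, `g ∈ G(𝔸_K)` (§1 supplies the scalars).
* §3 (unitary data `adelicGroupData F E c N J`, `U(J)(𝔸_F)` locally compact second countable, weak approximation at `∞`) `UnitaryGroup.` versions
  with `M = U(J)(𝔸_{F,f})`: **`exists_eq_ofChar_of_forall_finAdelicToAdelic_apply_eq_smul`** (scalars on the finite-adelic group ⇒ automorphic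
  character) and **`exists_eq_ofChar_of_forall_apply_eq_self_of_commutator_mem`** (a subgroup `N ∋` all `g⁻¹ (1,b)⁻¹ g (1,b)` acting trivially ⇒
  automorphic character).

CONSUMER (cell `hodgecm-mathlib`, crux H413 = stmt-HodgeConjecture-24833, line LH7, leaf ED. 3 print organ O8a `PKsaU2Shape`): `N` = the image of
`SU(Φ₂)(𝔸_{L⁺,f})` (which contains every commutator `g⁻¹ b⁻¹ g b` with `b` finite-adelic, `det` being a homomorphism and the archimedean part of
such a commutator being `1`) acts trivially on `P` after ★ Kneser saturation (`AutomorphicQuotientSaturation`) + (SA-SU2); then §3 gives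
`P = ofChar ψ μ₂` with `ψ` an automorphic character of `U(Φ₂)(𝔸_{L⁺})` trivial on `SU(Φ₂)(𝔸_{L⁺,f})` — the «`τ = θ ∘ det`» conclusion of the print
proof, up to the `det` dictionary (★ `UnitaryGroupDetCharacter`).  Nothing here is specific to unitary groups before §3.
HONEST LABEL: generic `L²` bookkeeping; HC_CM is proved only modulo the printed citations of that programme until its rung 0 closes; this file proves no
printed citation of it.

## References
* [DeitmarEchterhoff2014] A. Deitmar, S. Echterhoff, *Principles of Harmonic Analysis*, 2nd ed. (2014), Lemma 6.1.7 (Schur).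
* [BorelJacquet1979] A. Borel, H. Jacquet, *Automorphic forms and automorphic representations*, Proc. Sympos. Pure Math. XXXIII.1 (1979), §4.6.
* [PlatonovRapinchuk1994] V. Platonov, A. Rapinchuk, *Algebraic Groups and Number Theory* (1994), §7.3 Prop. 7.8, §7.4.
* [Zimmer1984] R. J. Zimmer, *Ergodic theory and semisimple groups* (1984), §2.2.
-/

set_option autoImplicit false

noncomputable section

open MeasureTheory Filter Set Topology NumberField
open scoped ENNReal Pointwise InnerProductSpace

namespace Literature.NumberTheory.Automorphic

namespace DiscreteAutomorphicRep

universe u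

variable {K : Type} [Field K] [NumberField K] {𝒢 : AdelicGroupData.{u} K}
  (μ : Measure 𝒢.automorphicQuotient) [𝒢.IsAutomorphicMeasure μ]

/-! ## §1 Schur for one element whose commutators act trivially -/

/-- **Schur for one element.**  Let `P` be a discrete automorphic representation and `m ∈ G(𝔸_K)` such that every commutator `g⁻¹ m⁻¹ g m` acts
trivially on `P`.  Then `R(m)` acts on `P` by a scalar: `R(g) R(m) = R(m) R(g) R(g⁻¹ m⁻¹ g m) = R(m) R(g)` on `P`, and `P` is topologically
irreducible and unitary (★ `isUnitary_rightRegular`, ★ Schur `IsTopIrreducible.exists_apply_eq_smul_of_commute`). [cite: DeitmarEchterhoff2014, Lemma 6.1.7] -/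
theorem exists_apply_eq_smul_of_forall_commutator_apply_eq_self (P : DiscreteAutomorphicRep 𝒢 μ) (m : 𝒢.Adelic)
    (hcomm : ∀ (g : 𝒢.Adelic) (v : P.space.toSubmodule), P.space.toContRep (g⁻¹ * m⁻¹ * g * m) v = v) :
    ∃ a : ℂ, ∀ v : P.space.toSubmodule, P.space.toContRep m v = a • v := by
  haveI : CompleteSpace P.space.toSubmodule := P.space.isClosed.completeSpace_coe
  have hU : P.space.toContRep.IsUnitary := (𝒢.isUnitary_rightRegular μ).toContRep P.space
  refine P.irreducible.exists_apply_eq_smul_of_commute hU (T := P.space.toContRep m) fun g => ?_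
  have h1 : g * m = m * g * (g⁻¹ * m⁻¹ * g * m) := by group
  rw [Commute, SemiconjBy]
  refine ContinuousLinearMap.ext fun v => ?_
  calc (P.space.toContRep g * P.space.toContRep m) v
      = P.space.toContRep (g * m) v := by rw [map_mul]
    _ = P.space.toContRep (m * g * (g⁻¹ * m⁻¹ * g * m)) v := by rw [← h1]
    _ = P.space.toContRep (m * g) (P.space.toContRep (g⁻¹ * m⁻¹ * g * m) v) := by rw [map_mul]; rfl
    _ = P.space.toContRep (m * g) v := by rw [hcomm g v]
    _ = (P.space.toContRep m * P.space.toContRep g) v := by rw [map_mul]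

/-- **Schur for a subgroup modulo a trivially-acting subgroup.**  If a subgroup `N` acts trivially on the discrete automorphic `P` and contains all
commutators `g⁻¹ m⁻¹ g m` (`g ∈ G(𝔸_K)`) of the elements `m` of a subgroup `M`, then `M` acts on `P` by scalars: there is `c : G(𝔸_K) → ℂ` with
`R(m) v = c(m) v` for `m ∈ M`, `v ∈ P`. [cite: DeitmarEchterhoff2014, Lemma 6.1.7] -/
theorem exists_forall_mem_apply_eq_smul_of_commutator_mem (P : DiscreteAutomorphicRep 𝒢 μ) (M N : Subgroup 𝒢.Adelic)
    (hN : ∀ n ∈ N, ∀ v : P.space.toSubmodule, P.space.toContRep n v = v)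
    (hcomm : ∀ m ∈ M, ∀ g : 𝒢.Adelic, g⁻¹ * m⁻¹ * g * m ∈ N) :
    ∃ c : 𝒢.Adelic → ℂ, ∀ m ∈ M, ∀ v : P.space.toSubmodule, P.space.toContRep m v = c m • v := by
  classical
  have h : ∀ m : 𝒢.Adelic, m ∈ M → ∃ a : ℂ, ∀ v : P.space.toSubmodule, P.space.toContRep m v = a • v := fun m hm =>
    exists_apply_eq_smul_of_forall_commutator_apply_eq_self μ P m fun g v => hN _ (hcomm m hm g) v
  refine ⟨fun m => if hm : m ∈ M then (h m hm).choose else 0, fun m hm v => ?_⟩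
  simp only [hm, dif_pos]
  exact (h m hm).choose_spec v

/-! ## §2 Scalar action of a closed normal subgroup with dense orbit ⇒ `P = ofChar ψ` -/

variable [LocallyCompactSpace 𝒢.Adelic] [SecondCountableTopology 𝒢.Adelic]

/-- **A discrete automorphic representation on which a closed normal `M ≤ G(𝔸_K)` with `M · (A_G · G(K))` dense acts by scalars is the line of an
automorphic character of ALL of `G(𝔸_K)`.**  The scalars `c(m)` are NOT assumed to extend to an automorphic character: every vector of `P` is a
`c`-eigenvector of `M` in `L²`, and two such with one of them non-zero are proportional (★
`AdelicGroupData.eq_zero_of_inner_eq_zero_of_forall_mem_rightRegular_apply_eq_smul`, the ergodicity of `M`), so `P` is one-dimensional and ★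
`exists_eq_ofChar_of_isOneDimensional` (eigencharacters are automorphic) concludes.  With `M = G(𝔸_{K,f})` (density = weak approximation at `∞`)
this is «an automorphic representation on which the finite-adelic group acts by scalars is an automorphic character». [cite: Zimmer1984, §2.2 Cor. 2.2.3]
[cite: BorelJacquet1979, §4.6] -/
theorem exists_eq_ofChar_of_forall_mem_apply_eq_smul (M : Subgroup 𝒢.Adelic) [M.Normal] (hM : IsClosed (M : Set 𝒢.Adelic))
    (hd : Dense ((M : Set 𝒢.Adelic) * (𝒢.quotientSubgroup : Set 𝒢.Adelic))) (P : DiscreteAutomorphicRep 𝒢 μ)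
    {c : 𝒢.Adelic → ℂ} (hP : ∀ m ∈ M, ∀ v : P.space.toSubmodule, P.space.toContRep m v = c m • v) :
    ∃ ψ : 𝒢.AutomorphicCharacter, P = ofChar ψ μ := by
  haveI := P.nontrivial_space
  obtain ⟨v, hv0⟩ := exists_ne (0 : P.space.toSubmodule)
  -- every vector of `P` is a `c`-eigenvector of `M` in `L²`
  have heig : ∀ w : P.space.toSubmodule, ∀ m ∈ M, 𝒢.rightRegular μ m (w : 𝒢.L2 μ) = c m • (w : 𝒢.L2 μ) := by
    intro w m hm
    have h1 := congrArg Subtype.val (hP m hm w)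
    rw [ContRepresentation.ClosedSubrep.coe_toContRep_apply] at h1
    exact h1
  have ha0 : (v : 𝒢.L2 μ) ≠ 0 := fun h => hv0 (Subtype.ext h)
  -- `P` is the line through `v`
  have hline : ∀ w : P.space.toSubmodule, ∃ a : ℂ, a • v = w := by
    intro w
    set a : 𝒢.L2 μ := (v : 𝒢.L2 μ) with ha_def
    set b : 𝒢.L2 μ := (w : 𝒢.L2 μ) with hb_def
    set c₀ : ℂ := ⟪a, b⟫_ℂ / ⟪a, a⟫_ℂ with hc₀
    have hh : ∀ m ∈ M, 𝒢.rightRegular μ m (b - c₀ • a) = c m • (b - c₀ • a) := by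
      intro m hm
      rw [map_sub, map_smul, heig v m hm, heig w m hm, smul_sub, smul_comm]
    have horth : ⟪a, b - c₀ • a⟫_ℂ = 0 := by
      rw [inner_sub_right, inner_smul_right, hc₀, div_mul_cancel₀ _ (inner_self_ne_zero.2 ha0), sub_self]
    have h0 : b - c₀ • a = 0 :=
      𝒢.eq_zero_of_inner_eq_zero_of_forall_mem_rightRegular_apply_eq_smul μ M hM hd (fun m hm => heig v m hm) hh ha0 horth
    rw [sub_eq_zero] at h0
    exact ⟨c₀, Subtype.ext (by rw [Submodule.coe_smul, ← h0])⟩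
  have h1 : P.IsOneDimensional := (finrank_eq_one_iff_of_nonzero' v hv0).2 hline
  exact exists_eq_ofChar_of_isOneDimensional μ P h1

/-- **A discrete automorphic representation on which a subgroup `N` acts trivially, `N` containing the commutators of `G(𝔸_K)` with a closed normal
`M` of dense orbit, is the line of an automorphic character** (§1 gives the scalars of `M`; then `exists_eq_ofChar_of_forall_mem_apply_eq_smul`).
On line LH7 ∕ O8a: `M = U(Φ₂)(𝔸_{L⁺,f})`, `N` = the image of `SU(Φ₂)(𝔸_{L⁺,f})` acting trivially after strong approximation.
[cite: Zimmer1984, §2.2 Cor. 2.2.3] [cite: DeitmarEchterhoff2014, Lemma 6.1.7] -/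
theorem exists_eq_ofChar_of_forall_mem_apply_eq_self_of_commutator_mem (M N : Subgroup 𝒢.Adelic) [M.Normal]
    (hM : IsClosed (M : Set 𝒢.Adelic)) (hd : Dense ((M : Set 𝒢.Adelic) * (𝒢.quotientSubgroup : Set 𝒢.Adelic)))
    (P : DiscreteAutomorphicRep 𝒢 μ) (hN : ∀ n ∈ N, ∀ v : P.space.toSubmodule, P.space.toContRep n v = v)
    (hcomm : ∀ m ∈ M, ∀ g : 𝒢.Adelic, g⁻¹ * m⁻¹ * g * m ∈ N) :
    ∃ ψ : 𝒢.AutomorphicCharacter, P = ofChar ψ μ := by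
  obtain ⟨c, hc⟩ := exists_forall_mem_apply_eq_smul_of_commutator_mem μ P M N hN hcomm
  exact exists_eq_ofChar_of_forall_mem_apply_eq_smul μ M hM hd P hc

end DiscreteAutomorphicRep

/-! ## §3 Unitary data: scalars (or trivial derived action) on `U(J)(𝔸_{F,f})` under weak approximation at `∞` -/

namespace UnitaryGroup

variable (F E : Type) [Field F] [NumberField F] [Field E] [NumberField E] [Algebra F E]
  (c : E ≃ₐ[F] E) (N : ℕ) (J : Matrix (Fin N) (Fin N) E)
  [LocallyCompactSpace (adelicGroupData F E c N J).Adelic] [SecondCountableTopology (adelicGroupData F E c N J).Adelic]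
  (μ : Measure (adelicGroupData F E c N J).automorphicQuotient) [(adelicGroupData F E c N J).IsAutomorphicMeasure μ]

/-- **Under weak approximation at `∞`, a discrete automorphic representation of `U(J)` on which `U(J)(𝔸_{F,f})` acts by scalars `a(g_f)` (any
scalars) is `ofChar ψ μ` for an automorphic character `ψ` of `U(J)(𝔸_F)`** (`DiscreteAutomorphicRep.exists_eq_ofChar_of_forall_mem_apply_eq_smul`
for the closed normal `finiteAdelic`, whose density hypothesis is ★ `dense_finiteAdelic_mul_quotientSubgroup_of_denseRange`).
[cite: PlatonovRapinchuk1994, §7.3 Prop. 7.8] [cite: BorelJacquet1979, §4.6] -/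
theorem exists_eq_ofChar_of_forall_finAdelicToAdelic_apply_eq_smul
    (hWA : DenseRange fun γ : (adelicGroupData F E c N J).Rational =>
      archPart F E c N J ((adelicGroupData F E c N J).toAdelic γ))
    (P : DiscreteAutomorphicRep (adelicGroupData F E c N J) μ) {a : finAdelic F E c N J → ℂ}
    (hP : ∀ (b : finAdelic F E c N J) (v : P.space.toSubmodule),
      P.space.toContRep (finAdelicToAdelic F E c N J b) v = a b • v) :
    ∃ ψ : (adelicGroupData F E c N J).AutomorphicCharacter, P = DiscreteAutomorphicRep.ofChar ψ μ := by
  classical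
  haveI := normal_finiteAdelic F E c N J
  -- scalars as a function on `U(J)(𝔸_F)` through the retraction `finPart`
  refine DiscreteAutomorphicRep.exists_eq_ofChar_of_forall_mem_apply_eq_smul μ (finiteAdelic F E c N J)
    (isClosed_finiteAdelic F E c N J) (dense_finiteAdelic_mul_quotientSubgroup_of_denseRange F E c N J hWA) P
    (c := fun g => a (finPart F E c N J g)) fun m hm v => ?_
  rw [← range_finAdelicToAdelic F E c N J] at hm
  obtain ⟨b, rfl⟩ := hm
  simp only [finPart_finAdelicToAdelic]
  exact hP b v

/-- **Under weak approximation at `∞`, a discrete automorphic representation of `U(J)` on which a subgroup `N₀ ≤ U(J)(𝔸_F)` containing all commutators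
`g⁻¹ (1, b)⁻¹ g (1, b)` (`b ∈ U(J)(𝔸_{F,f})`, `g ∈ U(J)(𝔸_F)`) acts trivially is `ofChar ψ μ` for an automorphic character `ψ`** (for `U(Φ₂)`: `N₀` =
the image of `SU(Φ₂)(𝔸_f)`, trivial on `P` after Kneser saturation + strong approximation — the O8a endgame).
[cite: PlatonovRapinchuk1994, §7.4] [cite: DeitmarEchterhoff2014, Lemma 6.1.7] -/
theorem exists_eq_ofChar_of_forall_apply_eq_self_of_commutator_mem
    (hWA : DenseRange fun γ : (adelicGroupData F E c N J).Rational =>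
      archPart F E c N J ((adelicGroupData F E c N J).toAdelic γ))
    (P : DiscreteAutomorphicRep (adelicGroupData F E c N J) μ) (N₀ : Subgroup (adelicGroupData F E c N J).Adelic)
    (hN₀ : ∀ n ∈ N₀, ∀ v : P.space.toSubmodule, P.space.toContRep n v = v)
    (hcomm : ∀ (b : finAdelic F E c N J) (g : (adelicGroupData F E c N J).Adelic),
      g⁻¹ * (finAdelicToAdelic F E c N J b)⁻¹ * g * finAdelicToAdelic F E c N J b ∈ N₀) :
    ∃ ψ : (adelicGroupData F E c N J).AutomorphicCharacter, P = DiscreteAutomorphicRep.ofChar ψ μ := by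
  haveI := normal_finiteAdelic F E c N J
  refine DiscreteAutomorphicRep.exists_eq_ofChar_of_forall_mem_apply_eq_self_of_commutator_mem μ (finiteAdelic F E c N J) N₀
    (isClosed_finiteAdelic F E c N J) (dense_finiteAdelic_mul_quotientSubgroup_of_denseRange F E c N J hWA) P hN₀ fun m hm g => ?_
  rw [← range_finAdelicToAdelic F E c N J] at hm
  obtain ⟨b, rfl⟩ := hm
  exact hcomm b g

end UnitaryGroup

end Literature.NumberTheory.Automorphic
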